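import Summits.CriticalPhenomena.SAWScalingLimit.Theses.SAWDefectDecoherence
import Summits.CriticalPhenomena.SAWScalingLimit.Theorems.BoundaryClosureNegative_Instance

/-!
# Refutation of `HexObservableLimit` (item stmt-CriticalPhenomena-5420)

`Summit.CriticalPhenomena.SAWScalingLimit.Theses.SAWDefectDecoherence.HexObservableLimit` — the averaged,
boundary-normalised form of Duminil-Copin–Smirnov 2012 Conjecture 2 shared verbatim (as the target) by the
routes SAWDefectDecoherence, SAWResidueField, SAWDevelopingMap, SAWPhaseRetrieval, SAWWindingAlias — is FALSE
as stated (refuted-misstated): its hypotheses tie the root mid-edge `a δ` to the marked point `D.pt 0` only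
through the EUCLIDEAN limit `δ·mid(a δ) → pt 0` (and `a δ ∈ ∂Λ_δ`), while the discretisation `Λ δ` is free
in the `o(1)`-collar at `∂D`; a boundary-hugging corridor relocates the conformally effective root.

## The corridor witness

* Domain: the upper half unit disc `HD` as a Jordan domain (`halfDiscJordan`), marked `pt 1 = 0` (flat
  there: `HD_inter_ball`) and `pt 0 = r` (`halfDiscDomain r`), with the explicit conformal map
  `Φ_r = Möbius ∘ square ∘ Cayley : HD → ℍ`, `r ↦ ∞`, `0 ↦ 0` (`PhiCE`, `PhiCE_apply`:
  `Φ_r z = (1-r)² z/((r-z)(1-rz))`), its boundary behaviour (`tendsto_norm_PhiCE`, `tendsto_PhiCE_zero`)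
  and a continuous logarithm of `Φ_r'` (`Lfun`, `exp_Lfun`, `tendsto_Lfun_zero`).
* Lattice: faces `fj j r` (row `r`, row-order index `j`), adjacency `adj_fj_iff`; the body `Lam δ false`
  = strip profile `|re c| ≤ √(δ⁻²-¾(r+1)²)` on rows `0 ≤ r` with half-width `≥ 1`, minus the row-0/row-1
  faces right of the junction cell `X = ⌈1/(2δ)⌉`; `Lam δ true` = body ∪ the row-0 corridor of cells
  `X < x₀ ≤ T = ⌊3/(4δ)⌋`. Both are connected (`preconnected_Lam`), simply connected
  (`simplyConnected_Lam`), inside `HD` after rescaling (`smul_center_mem_HD`), exactly the half-lattice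
  in `ball 0 ½` (`mem_Lam_iff_of_ball`), exhausting (`mem_Lam_of_thick`), with boundary roots
  `aEdge X`/`aEdge T` (`aEdge_mem_boundary`, limits `1/2`, `3/4`: `tendsto_smul_midpoint_aEdge`), the
  boundary normalisation edge `bEdge` below the origin face (limit `0`) and a straight SAW between them
  (`nonempty_saw`).
* Peeling (`observable_insert`): a face attached through a single neighbour can be removed
  from the root side at the cost of the factor `x e^{-iσθ}`; along the corridor
  (`observable_corridor`) `F^{body∪corridor}(a_T, z) = κ F^{body}(a_X, z)`, `κ ≠ 0`, for every
  mid-edge `z` above height `2`, whence identical normalised averages for small `δ` (`ratio_eq`).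
* Endgame: the conclusion (with its `c ≠ 0`) then gives `∫ψ e^{(5/8)(L_{1/2}-L_{1/2}(0))} =
  ∫ψ e^{(5/8)(L_{3/4}-L_{3/4}(0))}` for all test functions (`instance_limit`), so the two densities
  agree on `HD` (`eq_zero_of_forall_integral`), which forces `z (p-q)(1-pq) = 0` at a point of `HD`
  (`endgame`): contradiction.

REPAIR (the witness misses it): pin the root conformally — require at `pt 0` what is required at `pt 1`
(a ball in which `D` is a half-plane and `Λ δ` the exact half-lattice), or the canonical discretisation
`v ∈ Λ δ ↔ δ·c_v ∈ D.carrier`, or Carathéodory convergence of `(Ω_δ; a_δ, b_δ)`.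

Everything is proved (no named facts are used); `Polyline.winding` lemmas needed from
`HexParafermionProofs` are restated locally (`winding_cons_left_ray'`).
-/

noncomputable section

open Set Filter Topology Complex
open Literature.Probability.RandomPlanarGeometry
open Literature.Probability.LatticeModels Literature.Probability.RandomPlanarGeometry.SAW

namespace Summit.CriticalPhenomena.SAWScalingLimit.Theorems

open BoundaryClosure.Negative

/-- **Record of the replaced/dropped route item `HexObservableLimit`** = stmt-CriticalPhenomena-5420 (ledger signature verbatim;
NOT a route item): after `SAWDefectDecoherenceHexObservableLimit_refuted` below closed the item `refuted` at b90fe791a4c9, the route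
repair (`restate` with a new name, or `drop`) removed this constant from the gate-written Theses
file, while the Theorems file — append-only, statement text fixed — still names it ("Unknown
identifier" in the full builds of 2026-08-16). Re-declared here under its original fully-qualified
name and definiens solely so that this record keeps elaborating. FALSE (see the refutation below). -/
def _root_.Summit.CriticalPhenomena.SAWScalingLimit.Theses.SAWDefectDecoherence.HexObservableLimit : Prop :=
  ∃ c : ℂ, c ≠ 0 ∧ ∀ (D : Literature.Probability.RandomPlanarGeometry.DobrushinDomain) (ρ : ℝ) (Λ : ℝ → Finset Literature.Probability.LatticeModels.HexVertex) (m : ℝ → ℤ) (a b : ℝ → Sym2 Literature.Probability.LatticeModels.HexVertex) (Φ : Literature.Probability.RandomPlanarGeometry.ConformalEquiv D.carrier UpperHalfPlane.upperHalfPlaneSet) (L : ℂ → ℂ) (Lb : ℂ) (ψ : ℂ → ℂ), let F : ℝ → Sym2 Literature.Probability.LatticeModels.HexVertex → ℂ := fun δ z => Literature.Probability.RandomPlanarGeometry.SAW.hexParafermionicObservable (Λ δ) (a δ) Literature.Probability.RandomPlanarGeometry.SAW.hexCriticalFugacity (5 / 8) z; 0 < ρ → D.carrier ∩ Metric.ball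 (D.pt 1) ρ = {z : ℂ | (D.pt 1).im < z.im} ∩ Metric.ball (D.pt 1) ρ → (∀ᶠ δ : ℝ in nhdsWithin 0 (Set.Ioi 0), Literature.Probability.RandomPlanarGeometry.SAW.hexDomainSimplyConnected (Λ δ) ∧ a δ ∈ Literature.Probability.RandomPlanarGeometry.SAW.hexDomainBoundary (Λ δ) ∧ b δ ∈ Literature.Probability.RandomPlanarGeometry.SAW.hexDomainBoundary (Λ δ) ∧ Nonempty (Literature.Probability.RandomPlanarGeometry.SAW.HexMidEdgeSAW (Λ δ) (a δ) (b δ)) ∧ (Literature.Probability.LatticeModels.hexGraph.induce ((Λ δ : Finset Literature.Probability.LatticeModels.HexVertex) : Set Literature.Probability.LatticeModels.HexVertex)).Preconnected ∧ (∀ v ∈ Λ δ, (δ : ℂ) * Literature.Probability.LatticeModels.hexCenter v ∈ D.carrier) ∧ (∀ v : Literature.Probability.LatticeModels.HexVertex, (δ : ℂ) * Literature.Probability.LatticeModels.hexCenter v ∈ Metric.ball (D.pt 1) ρ → (v ∈ Λ δ ↔ m δ ≤ v.1 1))) → (∀ K : Set ℂ, IsCompact K → K ⊆ D.carrier → ∀ᶠ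 δ : ℝ in nhdsWithin 0 (Set.Ioi 0), ∀ v : Literature.Probability.LatticeModels.HexVertex, (δ : ℂ) * Literature.Probability.LatticeModels.hexCenter v ∈ K → v ∈ Λ δ) → Filter.Tendsto (fun δ : ℝ => (δ : ℂ) * Literature.Probability.RandomPlanarGeometry.SAW.hexMidpoint (a δ)) (nhdsWithin 0 (Set.Ioi 0)) (nhds (D.pt 0)) → Filter.Tendsto (fun δ : ℝ => (δ : ℂ) * Literature.Probability.RandomPlanarGeometry.SAW.hexMidpoint (b δ)) (nhdsWithin 0 (Set.Ioi 0)) (nhds (D.pt 1)) → Filter.Tendsto (fun x => ‖Φ x‖) (nhdsWithin (D.pt 0) D.carrier) Filter.atTop → Φ.HasBoundaryValue (D.pt 1) 0 → ContinuousOn L D.carrier → (∀ z ∈ D.carrier, Complex.exp (L z) = deriv Φ z) → Filter.Tendsto L (nhdsWithin (D.pt 1) D.carrier) (nhds Lb) → Continuous ψ → HasCompactSupport ψ → tsupport ψ ⊆ D.carrier → Filter.Tendsto (fun δ : ℝ => (δ : ℂ) ^ 2 * (∑ᶠ e ∈ Literature.Probability.RandomPlanarGeometry.SAW.hexDomainMidEdges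 (Λ δ), ψ ((δ : ℂ) * Literature.Probability.RandomPlanarGeometry.SAW.hexMidpoint e) * F δ e) / F δ (b δ)) (nhdsWithin 0 (Set.Ioi 0)) (nhds (c * ∫ z, ψ z * Complex.exp ((5 / 8 : ℂ) * (L z - Lb))))

/-- **Refutation of `HexObservableLimit`** (item stmt-CriticalPhenomena-5420, the shared target of the
routes SAWDefectDecoherence / SAWResidueField / SAWDevelopingMap / SAWPhaseRetrieval / SAWWindingAlias)
[refuted-misstated]. The hypotheses tie the root `a δ` to `D.pt 0` only through the Euclidean limit
`δ·mid(a δ) → pt 0` and `a δ ∈ ∂Λ_δ`, leaving `Λ δ` free in the `o(1)`-collar at `∂D`. WITNESS: `D` = the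
upper half unit disc (marked `pt 1 = 0`, flat there; `pt 0 = 1/2` resp. `3/4`), `Λ δ` = the strip-profile
discretisation of `D` with the row-`0`/row-`1` cells right of `X = ⌈1/(2δ)⌉` removed ("body", root at the
junction edge `aEdge X → 1/2`), resp. the body plus the row-`0` corridor of cells `X < x₀ ≤ T = ⌊3/(4δ)⌋`
(root at the tip edge `aEdge T → 3/4`): both satisfy every hypothesis (simply connected, connected, inside
`D`, exhausting, exact half-lattice in `ball 0 (1/2)`, a SAW to `b`); every walk from the tip traverses the
corridor, so peeling the corridor one face at a time gives `F^{body∪corridor}(a_T, z) = κ F^{body}(a_X, z)`,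
`κ ≠ 0`, at every mid-edge `z` above height `2`, hence IDENTICAL normalised averages for small `δ`; but the
conclusion predicts the limits `c∫ψ e^{(5/8)(L_q - L_q 0)}` and `c∫ψ e^{(5/8)(L_p - L_p 0)}` for the explicit
conformal maps `Φ_r(z) = (1-r)² z/((r-z)(1-rz))` (`r = 1/2, 3/4`), and `c ≠ 0` plus the test-function
lemma force `(p-z)(1-pz)/p = (q-z)(1-qz)/q` near `0`, i.e. `z (p-q)(1-pq) = 0`: contradiction.
REPAIRED STATEMENT C′ (the witness misses it): pin the root conformally — add at `pt 0` what is already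
required at `pt 1` (a `ρ₀`-ball where `D` is a half-plane and `Λ δ` is the exact half-lattice), or require
the canonical discretisation `v ∈ Λ δ ↔ δ·c_v ∈ D.carrier` for all `v`, or Carathéodory convergence of
`(Ω_δ; a_δ, b_δ)`. [folklore] -/
theorem SAWDefectDecoherenceHexObservableLimit_refuted :
    ¬ Summit.CriticalPhenomena.SAWScalingLimit.Theses.SAWDefectDecoherence.HexObservableLimit := by
  rintro ⟨c, hc, H⟩
  have hp : (0 : ℝ) < 3 / 4 ∧ (3 / 4 : ℝ) < 1 := by norm_num
  have hq : (0 : ℝ) < 1 / 2 ∧ (1 / 2 : ℝ) < 1 := by norm_num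
  have hx : hexCriticalFugacity ≠ 0 := hexCriticalFugacity_pos_lt_one.1.ne'
  -- Step 1: for every test function the two predicted limits coincide
  have key : ∀ ψ : ℂ → ℂ, Continuous ψ → HasCompactSupport ψ → tsupport ψ ⊆ HD →
      c * ∫ z, ψ z * Complex.exp ((5 / 8 : ℂ) * (Lfun (1 / 2) z - Lfun (1 / 2) 0)) =
        c * ∫ z, ψ z * Complex.exp ((5 / 8 : ℂ) * (Lfun (3 / 4) z - Lfun (3 / 4) 0)) := by
    intro ψ hψc hψK hψD
    have h1 := instance_limit H hq false (fun δ hδ => abs_Xc δ hδ) hψc hψK hψD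
    have h2 := instance_limit H hp true (fun δ hδ => abs_Tc δ hδ) hψc hψK hψD
    simp only [rootCell, Bool.false_eq_true, ↓reduceIte] at h1
    simp only [rootCell, ↓reduceIte] at h2
    -- the two normalised averages agree for small `δ`
    obtain ⟨ε, hε, -, hthick⟩ := exists_thick_of_isCompact hψK hψD
    have heq : (fun δ : ℝ => (δ : ℂ) ^ 2 * (∑ᶠ e ∈ hexDomainMidEdges (Lam δ true),
        ψ ((δ : ℂ) * hexMidpoint e) * hexParafermionicObservable (Lam δ true) (aEdge (Tc δ))
          hexCriticalFugacity (5 / 8) e) /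
        hexParafermionicObservable (Lam δ true) (aEdge (Tc δ)) hexCriticalFugacity (5 / 8) bEdge)
        =ᶠ[𝓝[>] 0]
        fun δ : ℝ => (δ : ℂ) ^ 2 * (∑ᶠ e ∈ hexDomainMidEdges (Lam δ false),
        ψ ((δ : ℂ) * hexMidpoint e) * hexParafermionicObservable (Lam δ false) (aEdge (Xc δ))
          hexCriticalFugacity (5 / 8) e) /
        hexParafermionicObservable (Lam δ false) (aEdge (Xc δ)) hexCriticalFugacity (5 / 8) bEdge := by
      filter_upwards [eventually_small (by positivity : 0 < ε / 2)] with δ hδ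
      obtain ⟨hδ, hδ', hδε⟩ := hδ
      refine ratio_eq hδ hδ' _ _ hx ψ fun e he => ?_
      have hmem : (δ : ℂ) * hexMidpoint e ∈ tsupport ψ := subset_tsupport _ he
      have him := (hthick _ hmem).2
      rw [Complex.im_ofReal_mul] at him
      by_contra hlt
      push Not at hlt
      nlinarith
    exact tendsto_nhds_unique h1 (h2.congr' heq)
  -- Step 2: the difference of the two densities is orthogonal to all test functions, hence zero
  have hG : ∀ z ∈ HD, Complex.exp ((5 / 8 : ℂ) * (Lfun (1 / 2) z - Lfun (1 / 2) 0)) =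
      Complex.exp ((5 / 8 : ℂ) * (Lfun (3 / 4) z - Lfun (3 / 4) 0)) := by
    intro z hz
    have := eq_zero_of_forall_integral isOpen_HD
      (G := fun z => Complex.exp ((5 / 8 : ℂ) * (Lfun (1 / 2) z - Lfun (1 / 2) 0)) -
        Complex.exp ((5 / 8 : ℂ) * (Lfun (3 / 4) z - Lfun (3 / 4) 0)))
      ((continuousOn_g hq).sub (continuousOn_g hp)) (fun ψ hψc hψK hψD => ?_) hz
    · exact sub_eq_zero.1 this
    · have i1 : MeasureTheory.Integrable fun z => ψ z * Complex.exp ((5 / 8 : ℂ) * (Lfun (1 / 2) z - Lfun (1 / 2) 0)) :=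
        (continuous_mul_of_tsupport_subset isOpen_HD hψc hψD (continuousOn_g hq)).integrable_of_hasCompactSupport
          hψK.mul_right
      have i2 : MeasureTheory.Integrable fun z => ψ z * Complex.exp ((5 / 8 : ℂ) * (Lfun (3 / 4) z - Lfun (3 / 4) 0)) :=
        (continuous_mul_of_tsupport_subset isOpen_HD hψc hψD (continuousOn_g hp)).integrable_of_hasCompactSupport
          hψK.mul_right
      show ∫ z, ψ z * (Complex.exp ((5 / 8 : ℂ) * (Lfun (1 / 2) z - Lfun (1 / 2) 0)) -
          Complex.exp ((5 / 8 : ℂ) * (Lfun (3 / 4) z - Lfun (3 / 4) 0))) = 0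
      have e : (fun z => ψ z * (Complex.exp ((5 / 8 : ℂ) * (Lfun (1 / 2) z - Lfun (1 / 2) 0)) -
          Complex.exp ((5 / 8 : ℂ) * (Lfun (3 / 4) z - Lfun (3 / 4) 0)))) =
          fun z => ψ z * Complex.exp ((5 / 8 : ℂ) * (Lfun (1 / 2) z - Lfun (1 / 2) 0)) -
            ψ z * Complex.exp ((5 / 8 : ℂ) * (Lfun (3 / 4) z - Lfun (3 / 4) 0)) := by
        funext z; ring
      rw [e, MeasureTheory.integral_sub i1 i2, sub_eq_zero]
      exact mul_left_cancel₀ hc (key ψ hψc hψK hψD)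
  -- Step 3: the two normalisations are incompatible
  exact endgame hp hq (by norm_num) hG

end Summit.CriticalPhenomena.SAWScalingLimit.Theorems
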